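import Summits.Parity.GeneralizedHardyLittlewood.Theorems.ZDegreeToeplitzBandLemma81ExtDil

/-!
# Route `ZDegreeToeplitzBand`, crux `PsiGradedTablesClosePoly` (stmt-Parity-22438), line `long_poly_dil`, stub
# `stub_lemma81LongPsiDil` (P2-Dil): Part 7 — the REPAIRED slot (cell heads `υ·1_{≤D⁴}`, `ν·1_{≤D⁴}`) reduced to its
# mean square, and the same reduction for P2 (`LongLegSplit.Lemma81LongPsi`, conjunct 3 of `stub_degOneLongSlots`)

Y. Zhang, *Discrete mean estimates and the Landau–Siegel zero*, arXiv:2211.02515v1 — an unrefereed manuscript under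
adjudication. **The programme SEARCHES and TYPES; no claim about Landau–Siegel zeros, Theorems 1–2 of arXiv:2211.02515
or a repaired Margin232 until a kernel theorem says so.**

`lemma81LongPsiDil_cell_of_meanSquare`: the conclusion of the corrected P2-Dil slot proposed in the budget memo
(BUDGET-P2Dil-g20.md §4, evidence on stmt-Parity-22438) — heads PINNED to the cell's `upsHead χ`, `nuHead χ` (class
members with `B = 1`: `LongLegSplit.upsHead_norm_le`, `nuHead_norm_le`), everything else verbatim — follows from the
`o(D·P²·𝓛³⁸)` mean square of the cell's product polynomial over `Ψ₁` on `𝔍(α)` (where (A) may be used on `υ, ν`: they are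
lacunary at primes under (A)). `lemma81LongPsi_of_meanSquare`: the non-dilated slot P2 = `∃ c₀ ∀ c′ ≥ c₀, Lemma81LongPsi c′`
follows from the `o(P²·𝓛³⁸)` mean square over ITS class (head `|b| ≤ Bτ²`, bounded `a₂`) — the same one-log wall as
P2-Dil, recorded for the planners of stub 4. Theorems only; no definitions; no new named facts. Prover: ls-knife-typer-3
g20 (cell landau-siegel §D), `--supports` stmt-Parity-22438. [cite: Zhang2022LandauSiegel, §8 Lemma 8.1 pp. 42–44; §2 (2.9)]
-/

noncomputable section

open Complex Real Set ComplexConjugate Finset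
open Literature.NumberTheory.LFunctions.Zhang2022
open Literature.NumberTheory.LFunctions.Zhang2022.Skeleton
open Literature.NumberTheory.LFunctions.Zhang2022.Section8aStatements
open Literature.NumberTheory.LFunctions.Zhang2022.KnifeEdge
open Literature.NumberTheory.LFunctions.Zhang2022.KnifeEdge.LongLegSplit

namespace Summit.Parity.GeneralizedHardyLittlewood.Theorems

/-- **THE REPAIRED P2-Dil (cell heads) MODULO ITS MEAN SQUARE.** If for every `δ > 0` and `K > 0`, for all large `D`
under (A), for all short sup-normalised pieces `g, f` with `θg + θf ≤ 2 − δ`, the two mean squares over `Ψ₁` of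
`A_{Nlong}(𝐚₁;s)A_{Nsupp}(ν1_{≤D⁴};1−s)` and its reflection along `𝔍(α)` are `≤ K·D·P²·𝓛³⁸`
(`𝐚₁ = longPsiData χ (dilHead D (upsHead χ)) g f`), then for every large `c′`, every `δ, ε > 0`, eventually in `D` under
(A), `‖lhs81Ext − (Theta1Ext + conj Theta1Ext′)‖ ≤ ε√D𝔓` at the cell datum — the corrected signature of stub 3.
[cite: Zhang2022LandauSiegel, §8 Lemma 8.1 pp. 42–44; §3 (3.1)] -/
theorem lemma81LongPsiDil_cell_of_meanSquare
    (hMS : ∀ δ : ℝ, 0 < δ → ∀ K : ℝ, 0 < K → ForAllLarge fun D _ χ => AssumptionA D χ →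
      ∀ (g g' f f' : ℝ → ℂ) (θg θf : ℝ),
        ShortPiece θg g g' → ShortPiece θf f f' → θg + θf ≤ 2 - δ →
        (∀ x ∈ Set.Icc (0:ℝ) 1, ‖g x‖ ≤ 1) → (∀ x ∈ Set.Icc (0:ℝ) 1, ‖f x‖ ≤ 1) →
        ∀ v ∈ Set.Icc (-ell1 D) (ell1 D),
          (∑ x ∈ finsetOf (PsiOne χ),
              ‖Lemma81.dirPoly (Nlong D) (longPsiData χ (dilHead D (upsHead χ)) g f) x.ψ
                    (((alpha D : ℝ) : ℂ) + s0 D + v * I) *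
                  Lemma81.dirPoly (Nsupp D) (nuHead χ) x.ψ⁻¹ (1 - (((alpha D : ℝ) : ℂ) + s0 D + v * I))‖ ^ 2 ≤
            K * D * bigP D ^ 2 * ell D ^ 38) ∧
          (∑ x ∈ finsetOf (PsiOne χ),
              ‖Lemma81.dirPoly (Nsupp D) (fun n => conj (nuHead χ n)) x.ψ (((alpha D : ℝ) : ℂ) + s0 D + v * I) *
                  Lemma81.dirPoly (Nlong D) (fun n => conj (longPsiData χ (dilHead D (upsHead χ)) g f n)) x.ψ⁻¹
                    (1 - (((alpha D : ℝ) : ℂ) + s0 D + v * I))‖ ^ 2 ≤ K * D * bigP D ^ 2 * ell D ^ 38)) :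
    ∃ c₀ : ℝ, ∀ c' : ℝ, c₀ ≤ c' → ∀ δ : ℝ, 0 < δ → ∀ ε : ℝ, 0 < ε →
      ForAllLarge fun D _ χ => AssumptionA D χ →
        ∀ (g g' f f' : ℝ → ℂ) (θg θf : ℝ),
          ShortPiece θg g g' → ShortPiece θf f f' → θg + θf ≤ 2 - δ →
          (∀ x ∈ Set.Icc (0:ℝ) 1, ‖g x‖ ≤ 1) → (∀ x ∈ Set.Icc (0:ℝ) 1, ‖f x‖ ≤ 1) →
            ‖lhs81Ext c' χ (Nlong D) (Nsupp D) (longPsiData χ (dilHead D (upsHead χ)) g f) (nuHead χ) -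
                (Theta1Ext c' χ (Nlong D) (Nsupp D) (longPsiData χ (dilHead D (upsHead χ)) g f) (nuHead χ) +
                  conj (Theta1Ext c' χ (Nsupp D) (Nlong D) (fun n => conj (nuHead χ n))
                    (fun n => conj (longPsiData χ (dilHead D (upsHead χ)) g f n))))‖
              ≤ ε * Real.sqrt D * frakP D := by
  obtain ⟨c₀, h⟩ := lemma81LongPsiDil_pointwise_of_meanSquare
  refine ⟨c₀, fun c' hc' δ hδ ε hε => ?_⟩
  obtain ⟨K, hK, hpt⟩ := h c' hc' 1 ε hε
  refine ((hpt.and (hMS δ hδ K hK)).mono ?_)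
  intro D _ χ _ _ hS hA g g' f f' θg θf hsg hsf hθ hg1 hf1
  obtain ⟨h1, h2⟩ := hS
  exact h1 hA (upsHead χ) g g' f f' (nuHead χ) hsg.inClass hsf.inClass hg1 hf1 (upsHead_norm_le χ)
    (nuHead_norm_le χ)
    (fun v hv => (h2 hA g g' f f' θg θf hsg hsf hθ hg1 hf1 v hv).1)
    (fun v hv => (h2 hA g g' f f' θg θf hsg hsf hθ hg1 hf1 v hv).2)

/-- `𝔓 → ∞`: for every `M`, `M ≤ 𝔓` for all large `D` ((2.9): `𝔓 ≥ ½P²𝓛⁻⁷⁷`, `P² = e^{2𝓛⁹} ≥ (2𝓛⁹)⁹/9!`).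
[cite: Zhang2022LandauSiegel, §2 (2.9)] -/
theorem lemma81Dil_exists_le_frakP (M : ℝ) : ∃ D₀ : ℕ, ∀ D : ℕ, D₀ ≤ D → M ≤ frakP D := by
  obtain ⟨D₁, hD₁⟩ := Ded81Edge.exists_frakP_ge_half
  obtain ⟨D₂, hD₂⟩ := Skeleton.exists_nat_forall_le_ell (1418 * |M| + 1)
  refine ⟨max D₁ D₂, fun D hD => ?_⟩
  have h1 := hD₁ D (le_trans (le_max_left _ _) hD)
  have hℓ := hD₂ D (le_trans (le_max_right _ _) hD)
  have hℓ1 : 1 ≤ ell D := by linarith [abs_nonneg M]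
  have hℓ0 : 0 < ell D := by linarith
  -- `e^{2𝓛⁹} ≥ (2𝓛⁹)⁹/9! = 512𝓛⁸¹/362880`
  have hexp : (2 * ell D ^ 9) ^ 9 / (Nat.factorial 9 : ℝ) ≤ Real.exp (ell D ^ 9) ^ 2 := by
    have h := Real.pow_div_factorial_le_exp (2 * ell D ^ 9) (by positivity) 9
    have e : Real.exp (ell D ^ 9) ^ 2 = Real.exp (2 * ell D ^ 9) := by rw [← Real.exp_nat_mul]; norm_num
    rw [e]; exact h
  have hfact : (Nat.factorial 9 : ℝ) = 362880 := by norm_num [Nat.factorial]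
  rw [hfact] at hexp
  have h81 : (2 * ell D ^ 9) ^ 9 = 512 * (ell D ^ 4 * ell D ^ 77) := by ring
  rw [h81] at hexp
  -- hence `𝔓 ≥ 𝓛⁴·512/(2·362880) ≥ M`
  have h77 : 0 < ell D ^ 77 := by positivity
  have hkey : 512 * ell D ^ 4 / 362880 / 2 ≤ frakP D := by
    have h2 : 512 * (ell D ^ 4 * ell D ^ 77) / 362880 * (ell D ^ 77)⁻¹ / 2 ≤ frakP D := by
      calc 512 * (ell D ^ 4 * ell D ^ 77) / 362880 * (ell D ^ 77)⁻¹ / 2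
          ≤ Real.exp (ell D ^ 9) ^ 2 * (ell D ^ 77)⁻¹ / 2 := by gcongr
        _ ≤ frakP D := h1
    have e : 512 * (ell D ^ 4 * ell D ^ 77) / 362880 * (ell D ^ 77)⁻¹ / 2 = 512 * ell D ^ 4 / 362880 / 2 := by
      field_simp
    linarith [e]
  have hℓ4 : ell D ≤ ell D ^ 4 := le_self_pow₀ hℓ1 (by norm_num)
  have hM : M ≤ |M| := le_abs_self M
  nlinarith [abs_nonneg M]

/-- **P2 (`LongLegSplit.Lemma81LongPsi`, NOT DILATED) MODULO ITS MEAN SQUARE**: the slot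
`∃ c₀ ∀ c′ ≥ c₀, Lemma81LongPsi c′` (conjunct 3 of `stub_degOneLongSlots`) follows from the `o(P²·𝓛³⁸)` mean square of
its product polynomial over its class (head `|b| ≤ Bτ²` of length `D⁵`, bounded `a₂` of length `< D⁴`). The same
one-log wall as for P2-Dil applies to this class (memo §3: `h(p) = 7` on `p ≤ D⁴`).
[cite: Zhang2022LandauSiegel, §8 Lemma 8.1 pp. 42–44; §3 Lemma 3.3] -/
theorem lemma81LongPsi_of_meanSquare
    (hMS : ∀ δ : ℝ, 0 < δ → ∀ B : ℝ, ∀ K : ℝ, 0 < K → ForAllLarge fun D _ χ => AssumptionA D χ →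
      ∀ (b : ℕ → ℂ) (g g' f f' : ℝ → ℂ) (a₂ : ℕ → ℂ) (θg θf : ℝ),
        ShortPiece θg g g' → ShortPiece θf f f' → θg + θf ≤ 2 - δ →
        (∀ x ∈ Set.Icc (0:ℝ) 1, ‖g x‖ ≤ 1) → (∀ x ∈ Set.Icc (0:ℝ) 1, ‖f x‖ ≤ 1) →
        (∀ n, ‖b n‖ ≤ B * ((Nat.divisors n).card : ℝ) ^ 2) → (∀ n : ℕ, D ^ 5 < n → b n = 0) →
        (∀ n, ‖a₂ n‖ ≤ B) → (∀ n : ℕ, D ^ 4 ≤ n → a₂ n = 0) →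
        ∀ v ∈ Set.Icc (-ell1 D) (ell1 D),
          (∑ x ∈ finsetOf (PsiOne χ),
              ‖Lemma81.dirPoly (Nlong D) (longPsiData χ b g f) x.ψ (((alpha D : ℝ) : ℂ) + s0 D + v * I) *
                  Lemma81.dirPoly (Nsupp D) a₂ x.ψ⁻¹ (1 - (((alpha D : ℝ) : ℂ) + s0 D + v * I))‖ ^ 2 ≤
            K * bigP D ^ 2 * ell D ^ 38) ∧
          (∑ x ∈ finsetOf (PsiOne χ),
              ‖Lemma81.dirPoly (Nsupp D) (fun n => conj (a₂ n)) x.ψ (((alpha D : ℝ) : ℂ) + s0 D + v * I) *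
                  Lemma81.dirPoly (Nlong D) (fun n => conj (longPsiData χ b g f n)) x.ψ⁻¹
                    (1 - (((alpha D : ℝ) : ℂ) + s0 D + v * I))‖ ^ 2 ≤ K * bigP D ^ 2 * ell D ^ 38)) :
    ∃ c₀ : ℝ, ∀ c' : ℝ, c₀ ≤ c' → LongLegSplit.Lemma81LongPsi c' := by
  obtain ⟨c₀, -, hgen⟩ := lemma81Ext_of_meanSquare_eventually
  refine ⟨c₀, fun c' hc' => ?_⟩
  intro δ hδ B ε hε
  obtain ⟨C, Dg, hg⟩ := hgen c' hc'
  set k : ℝ := ε / (4 * (|C| + 1)) with hk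
  have hk0 : 0 < k := by rw [hk]; positivity
  obtain ⟨D₁, hD₁⟩ := Ded81Edge.exists_frakP_ge_half
  obtain ⟨D₂, hD₂⟩ := Skeleton.exists_nat_forall_le_ell (|B| + 28)
  obtain ⟨D₃, hD₃⟩ := lemma81Dil_exists_le_frakP (2 / ε)
  obtain ⟨D₄, hMS'⟩ := hMS δ hδ B (k ^ 2) (by positivity)
  refine ⟨max (max Dg D₁) (max (max D₂ D₃) (max D₄ 1)), ?_⟩
  intro D _ χ hD hq hp hA b g g' f f' a₂ θg θf hsg hsf hθ hg1 hf1 hb hb0 ha₂ ha₂0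
  have hDg : Dg ≤ D := le_trans (le_trans (le_max_left _ _) (le_max_left _ _)) hD
  have hD1 := hD₁ D (le_trans (le_trans (le_max_right _ _) (le_max_left _ _)) hD)
  have hℓ := hD₂ D (le_trans (le_trans (le_trans (le_max_left _ _) (le_max_left _ _)) (le_max_right _ _)) hD)
  have h𝔓 := hD₃ D (le_trans (le_trans (le_trans (le_max_right _ _) (le_max_left _ _)) (le_max_right _ _)) hD)
  have hD4 : D₄ ≤ D := le_trans (le_trans (le_trans (le_max_left _ _) (le_max_right _ _)) (le_max_right _ _)) hD
  have hD1' : 1 ≤ D := le_trans (le_trans (le_trans (le_max_right _ _) (le_max_right _ _)) (le_max_right _ _)) hD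
  have hℓ1 : 1 ≤ ell D := by linarith [abs_nonneg B]
  have hMSD := hMS' D χ hD4 hq hp hA b g g' f f' a₂ θg θf hsg hsf hθ hg1 hf1 hb hb0 ha₂ ha₂0
  -- sizes
  obtain ⟨hN1, hN2, hsz1, -⟩ := lemma81Dil_sizes (B := B) hD1' hℓ
  have hB : 0 ≤ B := (norm_nonneg _).trans (ha₂ 0)
  have hlogP : 0 < Real.log (bigP D) := by rw [bigP, Real.log_exp]; positivity
  have hP1 : 1 ≤ bigP D := by rw [bigP]; exact Real.one_le_exp (by positivity)
  have hbd : ∀ d, ‖b d‖ ≤ (D : ℝ) * B * (d : ℝ) ^ 2 := fun d => by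
    have hτ : ((Nat.divisors d).card : ℝ) ≤ d := by exact_mod_cast Nat.card_divisors_le_self d
    have hD1r : (1 : ℝ) ≤ D := by exact_mod_cast hD1'
    calc ‖b d‖ ≤ B * ((Nat.divisors d).card : ℝ) ^ 2 := hb d
      _ ≤ B * (d : ℝ) ^ 2 := by gcongr
      _ = 1 * B * (d : ℝ) ^ 2 := by ring
      _ ≤ (D : ℝ) * B * (d : ℝ) ^ 2 := by gcongr
  have ha₁' : ∀ n, n < Nlong D → ‖longPsiData χ b g f n‖ ≤ bigP D ^ 10 := fun n hn =>
    (lemma81Dil_norm_longPsiData_le χ (M := (D : ℝ) * B) (by positivity) hbd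
      (lemma81Dil_norm_profData_le_one χ hlogP hsg.inClass hg1)
      (lemma81Dil_norm_profData_le_one χ hlogP hsf.inClass hf1) n).trans (hsz1 n hn)
  have ha₂' : ∀ n, n < Nsupp D → ‖a₂ n‖ ≤ bigP D ^ 10 := fun n _ => by
    calc ‖a₂ n‖ ≤ B := ha₂ n
      _ ≤ |B| + 28 := by linarith [le_abs_self B]
      _ ≤ ell D := hℓ
      _ ≤ ell D ^ 9 := le_self_pow₀ hℓ1 (by norm_num)
      _ ≤ Real.exp (ell D ^ 9) := by linarith [Real.add_one_le_exp (ell D ^ 9)]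
      _ = bigP D ^ 1 := by rw [bigP, pow_one]
      _ ≤ bigP D ^ 10 := pow_le_pow_right₀ hP1 (by norm_num)
  have key := hg D χ hDg hq hp hA (Nlong D) (Nsupp D) (longPsiData χ b g f) a₂
    (k ^ 2 * bigP D ^ 2 * ell D ^ 38) hN1 hN2 ha₁' ha₂' (fun v hv => (hMSD v hv).1) (fun v hv => (hMSD v hv).2)
  refine key.trans ?_
  -- the budget: `C𝓛⁻⁹⁶P·√(k²P²𝓛³⁸) = Ck·P²𝓛⁻⁷⁷ ≤ 2|C|k·𝔓 ≤ (ε/2)𝔓`, `1 ≤ (ε/2)𝔓`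
  have hP0 : 0 < bigP D := Real.exp_pos _
  have hℓ0 : 0 < ell D := by linarith
  have hsqrt : Real.sqrt (k ^ 2 * bigP D ^ 2 * ell D ^ 38) = k * bigP D * ell D ^ 19 := by
    have e : k ^ 2 * bigP D ^ 2 * ell D ^ 38 = (k * bigP D * ell D ^ 19) ^ 2 := by ring
    rw [e, Real.sqrt_sq (by positivity)]
  have hM : Real.exp (ell D ^ 9) ^ 2 * (ell D ^ 77)⁻¹ = bigP D ^ 2 * (ell D ^ 77)⁻¹ := by rw [bigP]
  rw [hM] at hD1
  have hmain : C * ((ell D ^ 96)⁻¹ * bigP D) * Real.sqrt (k ^ 2 * bigP D ^ 2 * ell D ^ 38) ≤ ε / 2 * frakP D := by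
    rw [hsqrt]
    have e : C * ((ell D ^ 96)⁻¹ * bigP D) * (k * bigP D * ell D ^ 19) = C * k * (bigP D ^ 2 * (ell D ^ 77)⁻¹) := by
      field_simp
    rw [e]
    have h2 : bigP D ^ 2 * (ell D ^ 77)⁻¹ ≤ 2 * frakP D := by linarith
    have h1 : C * k * (bigP D ^ 2 * (ell D ^ 77)⁻¹) ≤ |C| * k * (2 * frakP D) := by
      calc C * k * (bigP D ^ 2 * (ell D ^ 77)⁻¹) ≤ |C| * k * (bigP D ^ 2 * (ell D ^ 77)⁻¹) := by
            gcongr; exact le_abs_self C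
        _ ≤ |C| * k * (2 * frakP D) := by gcongr
    have h3 : |C| * k * 2 ≤ ε / 2 := by
      rw [hk]
      have hC1 : 0 < |C| + 1 := by positivity
      rw [show |C| * (ε / (4 * (|C| + 1))) * 2 = ε / 2 * (|C| / (|C| + 1)) by field_simp; ring]
      have : |C| / (|C| + 1) ≤ 1 := by rw [div_le_one hC1]; linarith
      nlinarith
    have h𝔓0 : 0 ≤ frakP D := le_trans (by positivity) h𝔓
    calc C * k * (bigP D ^ 2 * (ell D ^ 77)⁻¹) ≤ |C| * k * (2 * frakP D) := h1
      _ = (|C| * k * 2) * frakP D := by ring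
      _ ≤ ε / 2 * frakP D := mul_le_mul_of_nonneg_right h3 h𝔓0
  have hone : (1 : ℝ) ≤ ε / 2 * frakP D := by
    have h1 : (1 : ℝ) = ε / 2 * (2 / ε) := by field_simp
    rw [h1]
    exact mul_le_mul_of_nonneg_left h𝔓 (by positivity)
  linarith

end Summit.Parity.GeneralizedHardyLittlewood.Theorems

end
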